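import Summits.ValiantsHypothesis.ValiantsHypothesis.Theorems.MonotoneRestorationOrbitRestorationQPResidue
import Summits.ValiantsHypothesis.ValiantsHypothesis.Theorems.MonotoneRestorationOrbitRestorationQPPiSigmaValue
import Summits.ValiantsHypothesis.ValiantsHypothesis.Theorems.MonotoneRestorationOrbitRestorationQPValueOrbitFinset
import HarnessLib

/-!
# Route MonotoneRestoration — crux `OrbitRestorationQP` (stmt-ValiantsHypothesis-18293), line `depth-three-rung`:
# SUMS OF MATRIX-SYMMETRIC DEPTH-THREE TERMS RESTORE (A₁ per level, uniformly), and the residue shrinks again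

The landed stub A₁ (`stub_piSigmaValue`, p816670: one scaled product of affine forms, matrix-symmetric ⇒
quasi-polynomially orbit-restorable; rule M2′, `MatrixAffine.qpOrbitRestorable_of_matrixSymmetric`) is a FAMILY
statement with an existential constant.  Its proof is uniform in the exponent, so it yields a PER-LEVEL statement
with a constant depending on `c` only — and hence, through `ValueOrbit.qpOrbitRestorable_finset_sum` (uniform cost
`+3`, any number of summands), a new stratum of the rung `A_∞` that is NOT contained in the two landed ones
(tame factor multisets / small box volume): e.g. the Vandermonde of all `n²` entries `Π_{P<Q} (x_P − x_Q)`
(`n` even) has a twisted factor multiset of super-polynomial box volume, yet is a single matrix-symmetric term.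

* `qpOrbitRestorable_of_symmetricAffineProd` — **A₁ PER LEVEL, UNIFORM CONSTANT**: for every `c` there is `c'`
  such that every matrix-symmetric `p = C a · Π L` at level `n` (`L` a multiset of `≤ n^c + c` polynomials of total
  degree `≤ 1`) is `QPOrbitRestorable c' n p`;
* `qpOrbitRestorable_of_symmetricTerms` — **SUMS OF MATRIX-SYMMETRIC TERMS RESTORE**: for every `c` there is `c'`
  such that `p = Σ_{i<k} C(a i) · Π (L i)` (any `k`, every `|L i| ≤ n^c + c`, affine factors) with EVERY TERM
  matrix-symmetric is `QPOrbitRestorable c' n p`;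
* `sigmaPiSigmaValue_of_wildResidue₃` — **`A_∞` ⟸ THE THRICE-CARVED WILD RESIDUE**: the registered stub (verbatim)
  follows from the per-level statement about matrix-symmetric `p ∈ PDClass 1 n c` admitting NO cheap depth-three
  representation that is tame, NONE of small box volume, and NONE with all terms matrix-symmetric
  (cf. `Residue.sigmaPiSigmaValue_of_wildResidue`, which carves only the first two).

Everything is proved; the stub stays open; VP ≠ VNP is not touched. [folklore]

## References
* A. Dawar, G. Wilsenach, *Symmetric arithmetic circuits*, ToC 21 (2025), §3.3, Def. 6.1. [DawarWilsenach2025]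
* J. D. Dixon, B. Mortimer, *Permutation Groups*, GTM 163 (1996), Thm 5.2B. [DixonMortimer1996]
-/

noncomputable section

open scoped Classical Pointwise

-- `Summit.ValiantsHypothesis.ValiantsHypothesis.…` is the tree's single-conjunct layout (Sub = Summit).
set_option linter.dupNamespace false

namespace Summit.ValiantsHypothesis.ValiantsHypothesis.Theorems

namespace OrbitRestorationQPDepthThreeRung

namespace SymmetricTerms

open MvPolynomial Equiv Finset ProductAction Literature.Computability.AlgebraicComplexity Restorable SigmaKThresholds
  SigmaPiSigmaK

variable {n : ℕ}

/-! ### A₁ per level -/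

/-- **A₁ PER LEVEL WITH A UNIFORM CONSTANT.**  For every `c` there is `c'` such that at every level `n` every
matrix-symmetric scaled product `p = C a · Π L` of at most `n^c + c` polynomials of total degree `≤ 1` is
`QPOrbitRestorable c' n p`.  (The proof of `stub_piSigmaValue`, run at one level: beyond the threshold
`max (chooseThreshold 1 c) (max 9 (4(c+2)))` rule M2′ `MatrixAffine.qpOrbitRestorable_of_matrixSymmetric` with
`k = c + 2`; below it `Restorable.qpOrbitRestorable_of_invariant`.)
[folklore; cite: DawarWilsenach2025, §3.3; DixonMortimer1996, Thm 5.2B] -/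
theorem qpOrbitRestorable_of_symmetricAffineProd (c : ℕ) : ∃ c' : ℕ, ∀ (n : ℕ)
    (p : MvPolynomial (Fin n × Fin n) ℂ) (a : ℂ) (L : Multiset (MvPolynomial (Fin n × Fin n) ℂ)),
    (∀ ℓ ∈ L, ℓ.totalDegree ≤ 1) → Multiset.card L ≤ n ^ c + c → p = MvPolynomial.C a * L.prod →
    (∀ σ τ : Perm (Fin n), rename (fun q : Fin n × Fin n => (σ q.1, τ q.2)) p = p) →
    QPOrbitRestorable c' n p := by
  set N₀ : ℕ := max (chooseThreshold 1 c) (max 9 (4 * (c + 2))) with hN₀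
  refine ⟨max (2 * (c + 2) + 5) (N₀.factorial + 5), fun n p a L hL hcard hp hsym => ?_⟩
  by_cases hn : N₀ ≤ n
  · refine qpOrbitRestorable_mono (le_max_left _ _) ?_
    have hn1 : chooseThreshold 1 c ≤ n := le_trans (le_max_left _ _) hn
    have hn9 : 8 < n := by have := le_trans (le_max_right _ _) hn; omega
    have hn4 : 4 * (c + 2) ≤ n := by have := le_trans (le_max_right _ _) hn; omega
    by_cases hp0 : p = 0
    · rw [hp0, ← MvPolynomial.C_0]
      exact qpOrbitRestorable_mono (by omega) (qpOrbitRestorable_C 0)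
    obtain ⟨b, hb⟩ := affineProd_split L a hL
    set L₁ := L.filter fun ℓ => ℓ.totalDegree = 1 with hL₁
    rw [hb] at hp
    have hL1 : ∀ ℓ ∈ L₁, ℓ.totalDegree = 1 := fun ℓ hℓ => (Multiset.mem_filter.1 hℓ).2
    have hcard1 : Multiset.card L₁ < n.choose (c + 2) := by
      have h1 := Multiset.card_le_card (Multiset.filter_le (fun ℓ : MvPolynomial (Fin n × Fin n) ℂ =>
        ℓ.totalDegree = 1) L)
      have h2 := choose_gt_of_le hn1
      rw [one_mul] at h2
      exact lt_of_le_of_lt (h1.trans hcard) h2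
    have hp0' : MvPolynomial.C (a * b) * L₁.prod ≠ 0 := by rw [← hp]; exact hp0
    have hrow : ∀ σ : Perm (Fin n), vact (K := ℂ) rowHom σ (MvPolynomial.C (a * b) * L₁.prod) =
        MvPolynomial.C (a * b) * L₁.prod := by
      intro σ
      have h := hsym σ 1
      rw [rename_prod_eq, map_one, AlgEquiv.one_apply, hp] at h
      exact h
    have hcol : ∀ τ : Perm (Fin n), vact (K := ℂ) colHom τ (MvPolynomial.C (a * b) * L₁.prod) =
        MvPolynomial.C (a * b) * L₁.prod := by
      intro τ
      have h := hsym 1 τ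
      rw [rename_prod_eq, map_one, AlgEquiv.one_apply, hp] at h
      exact h
    rw [hp]
    exact MatrixAffine.qpOrbitRestorable_of_matrixSymmetric (k := c + 2) hn9 (by omega) hn4 L₁ (a * b) hL1 hcard1
      hp0' hrow hcol
  · have hlt : n < N₀ := not_le.1 hn
    refine qpOrbitRestorable_mono (le_max_right _ _) ?_
    exact qpOrbitRestorable_mono (Nat.add_le_add_right (Nat.factorial_le hlt.le) 5)
      (qpOrbitRestorable_of_invariant p (fun σ => ValueOrbit.ren_eq_of_matrixSymmetric hsym σ))

/-! ### Sums of matrix-symmetric terms -/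

/-- **SUMS OF MATRIX-SYMMETRIC DEPTH-THREE TERMS RESTORE.**  For every `c` there is `c'` such that every
`p = Σ_{i<k} C(a i) · Π (L i)` at level `n` — ANY number `k` of terms, every `L i` a multiset of at most `n^c + c`
polynomials of total degree `≤ 1` — in which EVERY TERM `C(a i) · Π (L i)` is matrix-symmetric (invariant under
independent row and column permutations) is `QPOrbitRestorable c' n p`.  (A₁ per level for each term, then
`ValueOrbit.qpOrbitRestorable_finset_sum` at uniform cost `+3`.) [folklore; cite: DawarWilsenach2025, §3.3] -/
theorem qpOrbitRestorable_of_symmetricTerms (c : ℕ) : ∃ c' : ℕ, ∀ (n : ℕ)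
    (p : MvPolynomial (Fin n × Fin n) ℂ) (k : ℕ) (a : Fin k → ℂ)
    (L : Fin k → Multiset (MvPolynomial (Fin n × Fin n) ℂ)),
    (∀ i, ∀ ℓ ∈ L i, ℓ.totalDegree ≤ 1) → (∀ i, Multiset.card (L i) ≤ n ^ c + c) →
    p = ∑ i, MvPolynomial.C (a i) * (L i).prod →
    (∀ i, ∀ σ τ : Perm (Fin n), rename (fun q : Fin n × Fin n => (σ q.1, τ q.2))
      (MvPolynomial.C (a i) * (L i).prod) = MvPolynomial.C (a i) * (L i).prod) →
    QPOrbitRestorable c' n p := by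
  obtain ⟨c₁, hc₁⟩ := qpOrbitRestorable_of_symmetricAffineProd c
  refine ⟨c₁ + 3, fun n p k a L hdeg hcard hp hsym => ?_⟩
  rw [hp]
  exact ValueOrbit.qpOrbitRestorable_finset_sum (Finset.univ : Finset (Fin k))
    (fun i => MvPolynomial.C (a i) * (L i).prod)
    fun i _ => hc₁ n _ (a i) (L i) (hdeg i) (hcard i) rfl (hsym i)

/-! ### The residue, carved three times -/

/-- **`A_∞` ⟸ THE THRICE-CARVED WILD RESIDUE.**  Suppose (`hW`) that for every `c` there is `c'` such that every
`p` at level `n` which is matrix-symmetric, lies in `PDClass (fun _ => 1) n c`, and has NO cheap depth-three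
representation `p = Σ_{i<k} C(a i) · Π (L i)` (affine factors) that is
(1) TAME within budget `c` (all `|L i| ≤ n^c + c`, every `L i` with `≤ 2^((log₂ n + c)^c)` diagonal translates), NOR
(2) of total BOX VOLUME `≤ n^c + c`, NOR
(3) TERM-WISE MATRIX-SYMMETRIC within budget `c` (all `|L i| ≤ n^c + c`, every term `C(a i) · Π (L i)` invariant
    under independent row and column permutations),
is `QPOrbitRestorable c' n p`.  Then the registered stub `stub_sigmaPiSigmaValue` (conclusion verbatim) holds.
[folklore] -/
theorem sigmaPiSigmaValue_of_wildResidue₃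
    (hW : ∀ c : ℕ, ∃ c' : ℕ, ∀ (n : ℕ) (p : MvPolynomial (Fin n × Fin n) ℂ),
      (∀ σ τ : Perm (Fin n), rename (fun q : Fin n × Fin n => (σ q.1, τ q.2)) p = p) →
      PDClass (fun _ => 1) n c p →
      (¬ ∃ (k : ℕ) (a : Fin k → ℂ) (L : Fin k → Multiset (MvPolynomial (Fin n × Fin n) ℂ)),
          (∀ i, ∀ ℓ ∈ L i, ℓ.totalDegree ≤ 1) ∧ (∀ i, Multiset.card (L i) ≤ n ^ c + c) ∧
          (∀ i, (Set.range fun σ : Perm (Fin n) => (L i).map (ren σ)).ncard ≤ 2 ^ ((Nat.log 2 n + c) ^ c)) ∧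
          p = ∑ i, MvPolynomial.C (a i) * (L i).prod) →
      (¬ ∃ (k : ℕ) (a : Fin k → ℂ) (L : Fin k → Multiset (MvPolynomial (Fin n × Fin n) ℂ)),
          (∀ i, ∀ ℓ ∈ L i, ℓ.totalDegree ≤ 1) ∧
          (∑ i, ∏ ℓ ∈ (L i).toFinset, ((L i).count ℓ + 1)) ≤ n ^ c + c ∧
          p = ∑ i, MvPolynomial.C (a i) * (L i).prod) →
      (¬ ∃ (k : ℕ) (a : Fin k → ℂ) (L : Fin k → Multiset (MvPolynomial (Fin n × Fin n) ℂ)),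
          (∀ i, ∀ ℓ ∈ L i, ℓ.totalDegree ≤ 1) ∧ (∀ i, Multiset.card (L i) ≤ n ^ c + c) ∧
          (∀ i, ∀ σ τ : Perm (Fin n), rename (fun q : Fin n × Fin n => (σ q.1, τ q.2))
            (MvPolynomial.C (a i) * (L i).prod) = MvPolynomial.C (a i) * (L i).prod) ∧
          p = ∑ i, MvPolynomial.C (a i) * (L i).prod) →
      QPOrbitRestorable c' n p) :
    ∀ f : (n : ℕ) → MvPolynomial (Fin n × Fin n) ℂ, IsMatrixSymmetric f →
      (∃ c : ℕ, ∀ n : ℕ, PDClass (fun _ => 1) n c (f n)) →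
      ∃ c : ℕ, ∀ n : ℕ, QPOrbitRestorable c n (f n) := by
  -- reduce to the twice-carved residue of `Residue.sigmaPiSigmaValue_of_wildResidue`
  refine Residue.sigmaPiSigmaValue_of_wildResidue fun c => ?_
  obtain ⟨cS, hS⟩ := qpOrbitRestorable_of_symmetricTerms c
  obtain ⟨cW, hcW⟩ := hW c
  refine ⟨max cS cW, fun n p hsym hPD htame hbox => ?_⟩
  by_cases hst : ∃ (k : ℕ) (a : Fin k → ℂ) (L : Fin k → Multiset (MvPolynomial (Fin n × Fin n) ℂ)),
      (∀ i, ∀ ℓ ∈ L i, ℓ.totalDegree ≤ 1) ∧ (∀ i, Multiset.card (L i) ≤ n ^ c + c) ∧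
      (∀ i, ∀ σ τ : Perm (Fin n), rename (fun q : Fin n × Fin n => (σ q.1, τ q.2))
        (MvPolynomial.C (a i) * (L i).prod) = MvPolynomial.C (a i) * (L i).prod) ∧
      p = ∑ i, MvPolynomial.C (a i) * (L i).prod
  · obtain ⟨k, a, L, hdeg, hcard, hts, hp⟩ := hst
    exact qpOrbitRestorable_mono (le_max_left _ _) (hS n p k a L hdeg hcard hp hts)
  · exact qpOrbitRestorable_mono (le_max_right _ _) (hcW n p hsym hPD htame hbox hst)

end SymmetricTerms

end OrbitRestorationQPDepthThreeRung

end Summit.ValiantsHypothesis.ValiantsHypothesis.Theorems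

end
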